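import Literature.NumberTheory.Transcendental.GammaIsoAlgebraicStep
import Literature.FieldTheory.Regular.RacDivisionTower
import HarnessLib

/-!
# Γ-fields: algebraic independence from the algebraic matroid, and regularity transfer

Toolkit for the proof of Bays–Kirby 2018, Prop. 11.2 (`Literature.NumberTheory.Transcendental.BaysKirby2018_prop_11_2`;
M. Bays, J. Kirby, *Pseudo-exponential maps, variants, and quasiminimality*, Algebra & Number
Theory 12 (2018), arXiv:1512.04262), exponential case inside a fixed exponential field `F`.

* `GammaField.algebraicIndependent_of_forall_not_mem_acl` — a finite family `u` with
  `uⱼ ∉ acl (C ∪ {uᵢ : i < j})` is algebraically independent over every intermediate field inside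
  `acl C` (bridge from the algebraic matroid of `GammaFields.lean` to Mathlib's
  `AlgebraicIndependent`).
* `GammaField.IsStrong.sup_span_of_forall_mem_acl` — Lemma 4.8 iterated: adjoining finitely many
  elements algebraic over the Γ-field of a strong `Λ` keeps it strong.
* `GammaField.exp_div_factorial_not_mem_acl` — for `x̄` algebraic over the Γ-field of a strong
  `B` and linearly independent over `B`, each division point `exp (xⱼ/m!)` is transcendental over
  `gens B`, the `x̄`, and the earlier `exp (xᵢ/m!)`; hence (`algebraicIndependent_exp_div_factorial_family`)
  every level `(exp (xⱼ/m!))ⱼ` is algebraically independent over any subfield of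
  `acl (gens B ∪ x̄)`.
* `GammaField.isAlgClosedIn_adjoinField_allGens_append` — **regularity transfer**: if the field
  `L₁ = ⟨K c₀⟩(x̄)` is relatively algebraically closed in `L₁(b, exp b)`, then so is the full
  Γ-field `⟨K c₀ x̄⟩ = L₁(exp (x̄/m!) : m)` in `⟨K c₀ x̄⟩(b, exp b)` — by
  `Literature.FieldTheory.Regular.mem_adjoin_iUnion_of_isAlgebraic` applied to the tower of
  division points of `exp x̄`. This supplies the regularity hypothesis of
  `Literature.FieldTheory.Regular.isPrime_map_ker_aeval` (absolute irreducibility of the locus of a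
  good basis, Cor. 7.4 / Lemma 8.3, proof) for the Γ-field generated by `c₀` and the generators
  `x̄` of the relative algebraic closure.

## References

* M. Bays, J. Kirby, *Pseudo-exponential maps, variants, and quasiminimality*, Algebra & Number
  Theory 12 (2018) 493–549: Def. 3.8, Lemma 4.8, §4.4, Cor. 7.4, Lemma 8.3 (proof), Prop. 11.2.
* S. Lang, *Algebra*, GTM 211, VIII §4.
-/

noncomputable section

open Set MvPolynomial

namespace Literature.NumberTheory.Transcendental

namespace GammaField

open Literature.ModelTheory.ExponentialFields.ExponentialRing ZilberHomogeneity
open Literature.FieldTheory.Regular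

variable {F : Type*} [Field F] [CharZero F] [Literature.ModelTheory.ExponentialFields.ExponentialRing F]
variable {K : Submodule ℚ F} {N : ℕ}

/-! ### Algebraic independence from the algebraic matroid -/

omit [Literature.ModelTheory.ExponentialFields.ExponentialRing F] in
/-- **Bridge.** If `uⱼ ∉ acl (C ∪ {uᵢ : i < j})` for every `j`, then `u` is algebraically
independent over every intermediate field `S` with `S ⊆ acl C`. [folklore] -/
theorem algebraicIndependent_of_forall_not_mem_acl {k : Type*} [Field k] [Algebra k F]
    (S : IntermediateField k F) {C : Set F} (hS : (S : Set F) ⊆ acl C) :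
    ∀ {s : ℕ} (u : Fin s → F), (∀ j : Fin s, u j ∉ acl (C ∪ u '' {i | i < j})) →
      AlgebraicIndependent S u
  | 0, u, _ => algebraicIndependent_empty_type
  | s + 1, u, hu => by
    -- split off the last element
    have hinit : AlgebraicIndependent S (u ∘ Fin.castSucc) := by
      refine algebraicIndependent_of_forall_not_mem_acl S hS (u ∘ Fin.castSucc) fun j hj => hu j.castSucc ?_
      refine acl_mono ?_ hj
      refine union_subset_union_right _ ?_
      rintro _ ⟨i, hi, rfl⟩
      exact ⟨i.castSucc, by simpa using hi, rfl⟩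
    have hlast : Transcendental (Algebra.adjoin S (range (u ∘ Fin.castSucc))) (u (Fin.last s)) := by
      refine transcendental_of_not_mem_acl _ ?_ (hu (Fin.last s))
      refine algebraAdjoin_subset_acl (fun r => acl_mono subset_union_left (hS r.2)) ?_
      rintro _ ⟨i, rfl⟩
      exact subset_acl _ (Or.inr ⟨i.castSucc, Fin.castSucc_lt_last i, rfl⟩)
    have hopt : AlgebraicIndependent S fun o : Option (Fin s) => o.elim (u (Fin.last s)) (u ∘ Fin.castSucc) :=
      AlgebraicIndependent.option_iff.2 ⟨hinit, hlast⟩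
    have hcomp : u = (fun o : Option (Fin s) => o.elim (u (Fin.last s)) (u ∘ Fin.castSucc)) ∘ finSuccEquivLast := by
      funext i
      refine Fin.lastCases ?_ (fun j => ?_) i
      · simp
      · simp
    rw [hcomp]
    exact (algebraicIndependent_equiv finSuccEquivLast).2 hopt

/-! ### Strong subspaces and finitely many algebraic elements -/

/-- **Lemma 4.8 iterated**: adjoining finitely many elements algebraic over the Γ-field of a
strong `Λ` keeps it strong. [cite: BaysKirby2018ANT, Lemma 4.8] -/
theorem IsStrong.sup_span_of_forall_mem_acl {Λ : Submodule ℚ F} (hΛ : IsStrong Λ) :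
    ∀ {s : ℕ} (x : Fin s → F), (∀ j, x j ∈ acl (gens Λ)) →
      IsStrong (Λ ⊔ Submodule.span ℚ (range x))
  | 0, x, _ => by
    rw [range_eq_empty x, Submodule.span_empty, sup_bot_eq]; exact hΛ
  | s + 1, x, hx => by
    have ih := IsStrong.sup_span_of_forall_mem_acl hΛ (x ∘ Fin.castSucc) fun j => hx j.castSucc
    have hrange : range x = insert (x (Fin.last s)) (range (x ∘ Fin.castSucc)) := by
      ext z
      simp only [mem_range, mem_insert_iff, Function.comp_apply]
      constructor
      · rintro ⟨i, rfl⟩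
        refine Fin.lastCases (Or.inl rfl) (fun j => Or.inr ⟨j, rfl⟩) i
      · rintro (rfl | ⟨j, rfl⟩)
        · exact ⟨_, rfl⟩
        · exact ⟨_, rfl⟩
    have hspan : Submodule.span ℚ (range x) =
        Submodule.span ℚ (range (x ∘ Fin.castSucc)) ⊔ Submodule.span ℚ {x (Fin.last s)} := by
      rw [hrange, Submodule.span_insert, sup_comm]
    rw [hspan, ← sup_assoc]
    by_cases hmem : x (Fin.last s) ∈ Λ ⊔ Submodule.span ℚ (range (x ∘ Fin.castSucc))
    · rw [sup_eq_left.2 ((Submodule.span_singleton_le_iff_mem _ _).2 hmem)]; exact ih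
    · exact isStrong_sup_span_singleton_of_mem_acl ih
        (acl_mono (gens_mono le_sup_left) (hx (Fin.last s))) hmem

/-! ### Division points of algebraic elements are algebraically independent -/

/-- For `x̄` algebraic over the Γ-field of a strong `B` and `ℚ`-linearly independent over `B`, the
division point `exp (xⱼ/m!)` is transcendental over `gens B`, all of `x̄`, and the earlier division
points `exp (xᵢ/m!)`, `i < j`. (Strongness of `B + ℚx₀ + ⋯ + ℚx_{j-1}`, Lemma 4.8, and
`exp_not_mem_acl_of_mem_acl`.) [cite: BaysKirby2018ANT, Lemma 4.8, §4.4] -/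
theorem exp_div_factorial_not_mem_acl {B : Submodule ℚ F} (hB : IsStrong B) {s : ℕ} {x : Fin s → F}
    (hxacl : ∀ j, x j ∈ acl (gens B)) (hxind : LinIndepOver B x) (m : ℕ) (j : Fin s) :
    exp (x j / (m.factorial : F)) ∉
      acl ((gens B ∪ range x) ∪ (fun i => exp (x i / (m.factorial : F))) '' {i | i < j}) := by
  classical
  -- the strong subspace `Λ = B + ℚ{xᵢ : i < j}`
  set xlt : Fin j → F := fun i => x (Fin.castLE j.is_lt.le i) with hxlt
  set Λ := B ⊔ Submodule.span ℚ (range xlt) with hΛ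
  have hΛs : IsStrong Λ := hB.sup_span_of_forall_mem_acl xlt fun i => hxacl _
  have hxjacl : x j ∈ acl (gens Λ) := acl_mono (gens_mono le_sup_left) (hxacl j)
  have hxjΛ : x j ∉ Λ := by
    intro hmem
    have hv : LinearIndependent ℚ (B.mkQ ∘ x) := (linIndepOver_iff B x).1 hxind
    obtain ⟨b, hb, w, hw, hsum⟩ := Submodule.mem_sup.1 hmem
    have hb0 : B.mkQ b = 0 := by
      rw [Submodule.mkQ_apply, Submodule.Quotient.mk_eq_zero]; exact hb
    have h1 : B.mkQ (x j) ∈ Submodule.span ℚ (B.mkQ '' range xlt) := by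
      rw [← Submodule.map_span, ← hsum, map_add, hb0, zero_add]
      exact Submodule.mem_map_of_mem hw
    have h2 : B.mkQ '' range xlt ⊆ (B.mkQ ∘ x) '' (univ \ {j}) := by
      rintro _ ⟨_, ⟨i, rfl⟩, rfl⟩
      refine ⟨Fin.castLE j.is_lt.le i, ⟨mem_univ _, fun hij => ?_⟩, rfl⟩
      have hval : ((Fin.castLE j.is_lt.le i : Fin s) : ℕ) = (j : ℕ) := congrArg Fin.val (mem_singleton_iff.1 hij)
      simp only [Fin.val_castLE] at hval
      exact absurd hval (ne_of_lt i.is_lt)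
    exact hv.notMem_span_image (show j ∉ (univ \ {j} : Set (Fin s)) by simp) (Submodule.span_mono h2 h1)
  have key := exp_not_mem_acl_of_mem_acl hΛs hxjacl hxjΛ
  -- compare the two `acl`s
  intro hmem
  apply key
  have hpow : exp (x j / (m.factorial : F)) ^ m.factorial = exp (x j) := by
    have := exp_div_factorial_eq_pow (x j) (Nat.zero_le m)
    simpa using this.symm
  have hmem' : exp (x j / (m.factorial : F)) ∈ acl (insert (x j) (gens Λ)) := by
    refine acl_subset_acl_of_subset ?_ hmem
    rintro z ((hz | ⟨i, rfl⟩) | ⟨i, hi, rfl⟩)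
    · exact subset_acl _ (mem_insert_of_mem _ (gens_mono le_sup_left hz))
    · exact acl_mono (subset_insert _ _) (acl_mono (gens_mono le_sup_left) (hxacl i))
    · refine subset_acl _ (mem_insert_of_mem _ (exp_mem_gens ?_))
      have hi' : (i : ℕ) < j := hi
      rw [div_natCast_eq_smul]
      refine Submodule.smul_mem _ _ (Submodule.mem_sup_right (Submodule.subset_span ⟨⟨i, hi'⟩, ?_⟩))
      simp only [hxlt]
      congr 1
  have := zpow_mem_acl hmem' (m.factorial : ℤ)
  rwa [zpow_natCast, hpow] at this

/-- **Every level of division points of `exp x̄` is algebraically independent** over any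
intermediate field inside `acl (gens B ∪ x̄)`, for `x̄` algebraic over the Γ-field of the strong
`B` and linearly independent over `B`. [cite: BaysKirby2018ANT, Lemma 4.8, §4.4] -/
theorem algebraicIndependent_exp_div_factorial_family {B : Submodule ℚ F} (hB : IsStrong B) {s : ℕ}
    {x : Fin s → F} (hxacl : ∀ j, x j ∈ acl (gens B)) (hxind : LinIndepOver B x)
    {k : Type*} [Field k] [Algebra k F] (S : IntermediateField k F)
    (hS : (S : Set F) ⊆ acl (gens B ∪ range x)) (m : ℕ) :
    AlgebraicIndependent S fun j => exp (x j / (m.factorial : F)) :=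
  algebraicIndependent_of_forall_not_mem_acl S hS _ (exp_div_factorial_not_mem_acl hB hxacl hxind m)

/-! ### The full Γ-field of `(c₀, x̄)` as a tower over `⟨K c₀⟩(x̄)` -/

omit [CharZero F] in
/-- `allGens (c₀, x̄)` consists of `allGens c₀`, the `x̄ⱼ`, and the division points
`exp (x̄ⱼ/m!)`. [folklore] -/
theorem allGens_append_eq {s : ℕ} (c₀ : Fin N → F) (x : Fin s → F) :
    allGens (Fin.append c₀ x) =
      (allGens c₀ ∪ range x) ∪ ⋃ m : ℕ, range fun j => exp (x j / (m.factorial : F)) := by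
  ext z
  simp only [allGens, mem_iUnion, mem_range, mem_union]
  constructor
  · rintro ⟨m, r, rfl⟩
    rcases r with r | r
    · refine Fin.addCases (fun i => ?_) (fun j => ?_) r
      · exact Or.inl (Or.inl ⟨m, Sum.inl i, by simp⟩)
      · exact Or.inl (Or.inr ⟨j, by simp⟩)
    · refine Fin.addCases (fun i => ?_) (fun j => ?_) r
      · exact Or.inl (Or.inl ⟨m, Sum.inr i, by simp⟩)
      · exact Or.inr ⟨m, j, by simp⟩
  · rintro ((⟨m, r, rfl⟩ | ⟨j, rfl⟩) | ⟨m, j, rfl⟩)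
    · rcases r with i | i
      · exact ⟨m, Sum.inl (Fin.castAdd s i), by simp⟩
      · exact ⟨m, Sum.inr (Fin.castAdd s i), by simp⟩
    · exact ⟨0, Sum.inl (Fin.natAdd N j), by simp⟩
    · exact ⟨m, Sum.inr (Fin.natAdd N j), by simp⟩

omit [CharZero F] [Literature.ModelTheory.ExponentialFields.ExponentialRing F] in
/-- Algebraicity over equal intermediate fields. [folklore] -/
theorem isAlgebraic_of_intermediateField_eq {k : Type*} [Field k] [Algebra k F]
    {E₁ E₂ : IntermediateField k F} (h : E₁ = E₂) {z : F} (hz : IsAlgebraic E₁ z) : IsAlgebraic E₂ z := by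
  subst h; exact hz

/-- **Regularity transfer to the full Γ-field.** Let `B = K + ℚc₀ + ℚb` be strong, `x̄` algebraic
over the Γ-field of `K + ℚc₀` and linearly independent over `B`, and suppose the field
`L₁ = ⟨K c₀⟩(x̄)` is relatively algebraically closed in `L₁(b, exp b)`. Then the full Γ-field
`⟨K c₀ x̄⟩ = L₁(exp (x̄ⱼ/m!) : j, m)` is relatively algebraically closed in `⟨K c₀ x̄⟩(b, exp b)`.
(The levels `(exp (x̄ⱼ/m!))ⱼ` are algebraically independent over `L₁(b, exp b)`, so
`Literature.FieldTheory.Regular.mem_adjoin_iUnion_of_isAlgebraic` applies.) This is the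
regularity hypothesis under which the locus of a good basis `(b, exp b)` over `⟨K c₀ x̄⟩` is
absolutely irreducible (`Literature.FieldTheory.Regular.isPrime_map_ker_aeval`).
[cite: BaysKirby2018ANT, Cor. 7.4, Lemma 8.3 (proof)] -/
theorem isAlgClosedIn_adjoinField_allGens_append {n s : ℕ} {c₀ : Fin N → F} {x : Fin s → F}
    {b : Fin n → F} (hB : IsStrong ((K ⊔ Submodule.span ℚ (range c₀)) ⊔ Submodule.span ℚ (range b)))
    (hxacl : ∀ j, x j ∈ acl (gens (K ⊔ Submodule.span ℚ (range c₀))))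
    (hxind : LinIndepOver ((K ⊔ Submodule.span ℚ (range c₀)) ⊔ Submodule.span ℚ (range b)) x)
    (hrac : ∀ z ∈ IntermediateField.adjoin (fieldOf K) ((allGens c₀ ∪ range x) ∪ range (gammaPt b)),
      IsAlgebraic (IntermediateField.adjoin (fieldOf K) (allGens c₀ ∪ range x)) z →
        z ∈ IntermediateField.adjoin (fieldOf K) (allGens c₀ ∪ range x)) :
    ∀ z ∈ IntermediateField.adjoin (fieldOf K) (allGens (Fin.append c₀ x) ∪ range (gammaPt b)),
      IsAlgebraic (IntermediateField.adjoin (fieldOf K) (allGens (Fin.append c₀ x))) z →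
        z ∈ IntermediateField.adjoin (fieldOf K) (allGens (Fin.append c₀ x)) := by
  classical
  have hle : IntermediateField.adjoin (fieldOf K) (allGens c₀ ∪ range x) ≤
      IntermediateField.adjoin (fieldOf K) ((allGens c₀ ∪ range x) ∪ range (gammaPt b)) :=
    IntermediateField.adjoin.mono _ _ _ subset_union_left
  set u : ℕ → Fin s → F := fun m j => exp (x j / (m.factorial : F)) with hu
  have hpow : ∀ m j, u (m + 1) j ^ (m + 1) = u m j := by
    intro m j
    simp only [hu]
    rw [← exp_nsmul, nsmul_eq_mul, Nat.factorial_succ, Nat.cast_mul]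
    congr 1
    have h1 : ((m + 1 : ℕ) : F) ≠ 0 := by exact_mod_cast Nat.succ_ne_zero m
    have h2 : ((m.factorial : ℕ) : F) ≠ 0 := by exact_mod_cast m.factorial_ne_zero
    field_simp
  -- the levels are algebraically independent over `L₁(b, exp b)`
  have hL₁β_acl : ((IntermediateField.adjoin (fieldOf K) ((allGens c₀ ∪ range x) ∪ range (gammaPt b)) :
      IntermediateField (fieldOf K) F) : Set F) ⊆
      acl (gens ((K ⊔ Submodule.span ℚ (range c₀)) ⊔ Submodule.span ℚ (range b)) ∪ range x) := by
    rw [show ((IntermediateField.adjoin (fieldOf K) ((allGens c₀ ∪ range x) ∪ range (gammaPt b)) :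
        IntermediateField (fieldOf K) F) : Set F) = ((IntermediateField.adjoin (fieldOf K)
        ((allGens c₀ ∪ range x) ∪ range (gammaPt b))).toSubfield : Set F) from rfl,
      IntermediateField.adjoin_toSubfield]
    refine (subfieldClosure_subset_acl _).trans (acl_subset_acl_of_subset ?_)
    rintro z (⟨k, rfl⟩ | ((hz | hz) | ⟨r, rfl⟩))
    · exact acl_mono (subset_union_left.trans' (gens_mono (le_sup_left.trans le_sup_left)))
        (fieldOf_subset_acl K k.2)
    · exact subset_acl _ (Or.inl (gens_mono le_sup_left (allGens_subset_gens K c₀ hz)))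
    · exact subset_acl _ (Or.inr hz)
    · refine subset_acl _ (Or.inl ?_)
      rcases r with i | i
      · exact mem_gens_of_mem (Submodule.mem_sup_right (Submodule.subset_span ⟨i, rfl⟩))
      · exact exp_mem_gens (Submodule.mem_sup_right (Submodule.subset_span ⟨i, rfl⟩))
  have hind : ∀ m, AlgebraicIndependent
      (IntermediateField.adjoin (fieldOf K) ((allGens c₀ ∪ range x) ∪ range (gammaPt b))) (u m) := fun m =>
    algebraicIndependent_exp_div_factorial_family hB (fun j => acl_mono (gens_mono le_sup_left) (hxacl j))
      hxind _ hL₁β_acl m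
  -- identification of the big fields with the towers
  have hEc : IntermediateField.adjoin (fieldOf K) (allGens (Fin.append c₀ x)) =
      (IntermediateField.adjoin (IntermediateField.adjoin (fieldOf K) (allGens c₀ ∪ range x))
        (⋃ m, range (u m))).restrictScalars (fieldOf K) := by
    rw [IntermediateField.adjoin_adjoin_left, allGens_append_eq]
  have hEcβ : IntermediateField.adjoin (fieldOf K) (allGens (Fin.append c₀ x) ∪ range (gammaPt b)) =
      (IntermediateField.adjoin (IntermediateField.adjoin (fieldOf K) ((allGens c₀ ∪ range x) ∪ range (gammaPt b)))
        (⋃ m, range (u m))).restrictScalars (fieldOf K) := by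
    rw [IntermediateField.adjoin_adjoin_left, allGens_append_eq, Set.union_right_comm]
  intro z hz halg
  have hz' : z ∈ IntermediateField.adjoin
      (IntermediateField.adjoin (fieldOf K) ((allGens c₀ ∪ range x) ∪ range (gammaPt b))) (⋃ m, range (u m)) := by
    rw [← IntermediateField.mem_restrictScalars (fieldOf K), ← hEcβ]; exact hz
  have halg' := isAlgebraic_of_intermediateField_eq hEc halg
  have hgoal := mem_adjoin_iUnion_of_isAlgebraic hle (fun z hz halg => hrac z hz halg) u hpow hind hz' halg'
  rw [hEc, IntermediateField.mem_restrictScalars]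
  exact hgoal

end GammaField

end Literature.NumberTheory.Transcendental
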